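import Summits.HodgeConjecture.CorCM.Census.CentralSquaresSwapCalculus

/-!
# The square-central class, L: the metric of a multi-partner base block — unique nearest base changes below level `m`

COR-CM (cell `pub-hodgecm2`), count-neutral kernel combinatorics by the binder seat b09 (gen 50; lane SQUARE-CENTRAL CLASS, part L), on part III
(`Census/CentralSquaresSwapCalculus.lean`: `ddist_eq_card_symmDiff`, `ddist_compl_base_eq`, `ddist_compl_eq`, the four-type metric of §4 there) and gen 38ʼs
`Census/BaseBlockCovering.lean` (`bpot`, `bpot_le`, `exists_bpot_eq`), BY NAME.  Theorems only: no definition, no `decide`, no certificate, no named fact, no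
`sorry`.  HONEST FRAMING: `HC_CM` is NOT proved, here or anywhere in the tree; nothing here is a period or a headline.

THE MULTI-PARTNER BLOCK (part XLIX, `Census/CentralSquaresPartners.lean`): the base changes of `T₀` are `T₀`, `T̄₀`, the partners `T₁ ∈ 𝒯` and their
complements (`hbase`); `|T₀| = 4m` and every partner differs from `T₀` at `|𝓗₁| = 2m` places (`𝓗₁ = T₀ ∖ T₁`); in the affine blocks of the square-central rows
any two partners also differ at `2m` places (`hpair`).  Part IIIʼs four-type metric (`ddist_rt_base_cases`, `unique_T₀_of_lt`, `unique_T₁_of_lt`) assumed ONE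
partner; this file is its multi-partner form — the input every star-normal-form argument of parts IV–VII needs when it is run inside an eight- or sixteen-type
block.  With `D = D(X) = T₀ ∖ X` the deviation set of a type `X`:

* §1 `card_le_card_symmDiff_add`, `card_symmDiff_le_add`, `card_symmDiff_triangle`: the triangle inequalities for `|A ∆ B|`.
* §2 `ddist_rt_partners_cases`: every base-change distance of `X` is `|D|`, `n − |D|`, `|𝓗₁ ∆ D|` or `n − |𝓗₁ ∆ D|` for a partner `T₁`;
  `le_ddist_rt_of_partners`: each of them is `≥ 2m − |D|`… precisely `|D| ≤ ddist` whenever `|D| ≤ m` (`bpot_eq_card_dev_of_le_m`: **`bpot X = |D|` for `|D| ≤ m`**).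
* §3 **`T₀` UNIQUELY NEAREST BELOW LEVEL `m`** (`unique_T₀_of_card_lt_m`): if `|D| < m`, every nearest base change of `X` is `T₀`.
* §4 **THE PARTNER VERSION** (`bpot_eq_card_symmDiff_of_le_m`, `unique_partner_of_card_lt_m`): if `|𝓗₁ ∆ D| < m` for a partner `T₁ = T₀·Q₁⁻¹` (pairwise
  partner distance `2m`), then `bpot X = |𝓗₁ ∆ D|` and every nearest base change of `X` is `T₁`.

## References
* [Pohlmann1968] H. Pohlmann, Algebraic cycles on abelian varieties of complex multiplication type, Ann. of Math. 88 (1968), Thm 1.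
-/

namespace Summit.HodgeConjecture.CorCM.Census.CentralSquares

open Finset
open scoped symmDiff
open Summit.HodgeConjecture.CorCM.Prior.AllgGroup.RfwfAllgGroup
open Summit.HodgeConjecture.CorCM.Census.BlockParity
open Summit.HodgeConjecture.CorCM.Census.Coinvariant
open Summit.HodgeConjecture.CorCM.Census.TwistGeneration
open Summit.HodgeConjecture.CorCM.Census.BaseBlock

noncomputable section

variable {G : Type*} [Group G] [Fintype G] [DecidableEq G] (c : G) (T₀ : CMF G c)

/-! ## §1 Triangle inequalities for symmetric differences -/

omit [Group G] [Fintype G] in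
/-- `|A| ≤ |A ∆ B| + |B|`. [folklore] -/
theorem card_le_card_symmDiff_add (A B : Finset G) : A.card ≤ (A ∆ B).card + B.card := by
  calc A.card ≤ ((A ∆ B) ∪ B).card := card_le_card fun x hx => by
        rw [mem_union, mem_symmDiff]; by_cases hB : x ∈ B <;> tauto
    _ ≤ (A ∆ B).card + B.card := card_union_le _ _

omit [Group G] [Fintype G] in
/-- `|A ∆ B| ≤ |A| + |B|`. [folklore] -/
theorem card_symmDiff_le_add (A B : Finset G) : (A ∆ B).card ≤ A.card + B.card := by
  calc (A ∆ B).card ≤ (A ∪ B).card := card_le_card fun x hx => by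
        rw [mem_symmDiff] at hx; rw [mem_union]; tauto
    _ ≤ A.card + B.card := card_union_le _ _

omit [Group G] [Fintype G] in
/-- `|A ∆ C| ≤ |A ∆ B| + |B ∆ C|`. [folklore] -/
theorem card_symmDiff_triangle (A B C : Finset G) : (A ∆ C).card ≤ (A ∆ B).card + (B ∆ C).card := by
  calc (A ∆ C).card ≤ ((A ∆ B) ∪ (B ∆ C)).card := card_le_card fun x hx => by
        have h : A ∆ C ≤ A ∆ B ⊔ B ∆ C := symmDiff_triangle A B C
        exact h hx
    _ ≤ (A ∆ B).card + (B ∆ C).card := card_union_le _ _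

omit [Group G] [Fintype G] in
/-- `|A ∆ B| ≤ |A ∆ C| + |B ∆ C|` — hence `|A ∆ B| − |B ∆ C| ≤ |A ∆ C|`. [folklore] -/
theorem card_symmDiff_le_triangle (A B C : Finset G) : (A ∆ B).card ≤ (A ∆ C).card + (C ∆ B).card :=
  card_symmDiff_triangle A C B

/-! ## §2 The base-change distances of a multi-partner block -/

section Partners

variable (𝒯 : Finset (CMF G c))
variable (hbase : ∀ Q : G, rt c Q T₀ = T₀ ∨ rt c Q T₀ = rt c c T₀ ∨ ∃ T₁ ∈ 𝒯, rt c Q T₀ = T₁ ∨ rt c Q T₀ = rt c c T₁)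
variable (m : ℕ) (hn : T₀.1.card = 4 * m) (hH : ∀ T₁ ∈ 𝒯, (T₀.1 \ T₁.1).card = 2 * m)

include hbase in
/-- **The base-change distances.**  In a multi-partner block the distance from any base change of `T₀` to `X` is `|D|`, `n − |D|`, or `|𝓗₁ ∆ D|`,
`n − |𝓗₁ ∆ D|` for some partner `T₁ ∈ 𝒯` (`D = D(X)`, `𝓗₁ = T₀ ∖ T₁`, `n = |T₀|`). [folklore] -/
theorem ddist_rt_partners_cases (hc2 : c * c = 1) (hcen : ∀ x : G, x * c = c * x) (Q : G) (X : CMF G c) :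
    ddist (rt c Q T₀) X = (T₀.1 \ X.1).card ∨ ddist (rt c Q T₀) X = T₀.1.card - (T₀.1 \ X.1).card ∨
      ∃ T₁ ∈ 𝒯, ddist (rt c Q T₀) X = ((T₀.1 \ T₁.1) ∆ (T₀.1 \ X.1)).card ∨
        ddist (rt c Q T₀) X = T₀.1.card - ((T₀.1 \ T₁.1) ∆ (T₀.1 \ X.1)).card := by
  rcases hbase Q with h | h | ⟨T₁, hT₁, h | h⟩ <;> rw [h]
  · exact Or.inl rfl
  · exact Or.inr (Or.inl (ddist_compl_base_eq c T₀ hc2 hcen X))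
  · exact Or.inr (Or.inr ⟨T₁, hT₁, Or.inl (ddist_eq_card_symmDiff c T₀ hc2 T₁ X)⟩)
  · exact Or.inr (Or.inr ⟨T₁, hT₁, Or.inr (ddist_compl_eq c T₀ hc2 hcen T₁ X)⟩)

include hbase hn hH in
/-- **`|D| ≤` every base-change distance when `|D| ≤ m`**: the partners are at distance `2m`, so `|𝓗₁ ∆ D| ≥ 2m − |D| ≥ |D|` and the complements are farther
still. [folklore] -/
theorem card_dev_le_ddist_rt_of_le_m (hc2 : c * c = 1) (hcen : ∀ x : G, x * c = c * x) (X : CMF G c)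
    (hD : (T₀.1 \ X.1).card ≤ m) (Q : G) : (T₀.1 \ X.1).card ≤ ddist (rt c Q T₀) X := by
  rcases ddist_rt_partners_cases c T₀ 𝒯 hbase hc2 hcen Q X with h | h | ⟨T₁, hT₁, h | h⟩ <;> rw [h]
  · omega
  · have h1 := card_le_card_symmDiff_add (T₀.1 \ T₁.1) (T₀.1 \ X.1)
    have h2 := hH T₁ hT₁
    rw [symmDiff_comm] at h1
    have h3 : ((T₀.1 \ X.1) ∆ (T₀.1 \ T₁.1)).card = ((T₀.1 \ T₁.1) ∆ (T₀.1 \ X.1)).card := by rw [symmDiff_comm]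
    omega
  · have h1 := card_symmDiff_le_add (T₀.1 \ T₁.1) (T₀.1 \ X.1)
    have h2 := hH T₁ hT₁
    omega

include hbase hn hH in
/-- **`bpot X = |D|` when `|D| ≤ m`.** [folklore] -/
theorem bpot_eq_card_dev_of_le_m (hc2 : c * c = 1) (hcen : ∀ x : G, x * c = c * x) (X : CMF G c)
    (hD : (T₀.1 \ X.1).card ≤ m) : bpot c T₀ X = (T₀.1 \ X.1).card := by
  apply le_antisymm
  · have h := bpot_le c T₀ X 1; rwa [rt_one] at h
  · obtain ⟨Q, hQ⟩ := exists_bpot_eq c T₀ X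
    rw [hQ]
    exact card_dev_le_ddist_rt_of_le_m c T₀ 𝒯 hbase m hn hH hc2 hcen X hD Q

/-! ## §3 `T₀` uniquely nearest below level `m` -/

include hbase hn hH in
/-- **`T₀` UNIQUELY NEAREST BELOW LEVEL `m`**: if `|D(X)| < m`, every nearest base change of `X` is `T₀` — whatever the number of partners. [folklore] -/
theorem unique_T₀_of_card_lt_m (hc2 : c * c = 1) (hcen : ∀ x : G, x * c = c * x) (X : CMF G c)
    (hD : (T₀.1 \ X.1).card < m) :
    ∀ Q' : G, ddist (rt c Q' T₀) X = bpot c T₀ X → rt c Q' T₀ = rt c (1 : G) T₀ := by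
  intro Q' hQ'
  rw [rt_one]
  rw [bpot_eq_card_dev_of_le_m c T₀ 𝒯 hbase m hn hH hc2 hcen X hD.le] at hQ'
  rcases hbase Q' with h | h | ⟨T₁, hT₁, h | h⟩
  · exact h
  · exfalso; rw [h, ddist_compl_base_eq c T₀ hc2 hcen] at hQ'; omega
  · exfalso
    rw [h, ddist_eq_card_symmDiff c T₀ hc2] at hQ'
    have h1 := card_le_card_symmDiff_add (T₀.1 \ T₁.1) (T₀.1 \ X.1)
    have h2 := hH T₁ hT₁
    omega
  · exfalso
    rw [h, ddist_compl_eq c T₀ hc2 hcen] at hQ'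
    have h1 := card_symmDiff_le_add (T₀.1 \ T₁.1) (T₀.1 \ X.1)
    have h2 := hH T₁ hT₁
    omega

/-! ## §4 A partner uniquely nearest below level `m` of its own frame -/

variable (hpair : ∀ T₁ ∈ 𝒯, ∀ T₂ ∈ 𝒯, T₁ ≠ T₂ → ((T₀.1 \ T₁.1) ∆ (T₀.1 \ T₂.1)).card = 2 * m)

include hbase hn hH hpair in
/-- **`|𝓗₁ ∆ D| ≤` every base-change distance when `|𝓗₁ ∆ D| ≤ m`** (partner `T₁`, pairwise partner distance `2m`). [folklore] -/
theorem card_symmDiff_le_ddist_rt_of_le_m (hc2 : c * c = 1) (hcen : ∀ x : G, x * c = c * x) (X : CMF G c) {T₁ : CMF G c} (hT₁ : T₁ ∈ 𝒯)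
    (hD : ((T₀.1 \ T₁.1) ∆ (T₀.1 \ X.1)).card ≤ m) (Q : G) : ((T₀.1 \ T₁.1) ∆ (T₀.1 \ X.1)).card ≤ ddist (rt c Q T₀) X := by
  have hH₁ := hH T₁ hT₁
  rcases ddist_rt_partners_cases c T₀ 𝒯 hbase hc2 hcen Q X with h | h | ⟨T₂, hT₂, h | h⟩ <;> rw [h]
  · -- `|𝓗₁| ≤ |𝓗₁ ∆ D| + |D|`
    have h1 := card_le_card_symmDiff_add (T₀.1 \ T₁.1) (T₀.1 \ X.1)
    omega
  · -- `|D| ≤ |D ∆ 𝓗₁| + |𝓗₁|`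
    have h1 := card_le_card_symmDiff_add (T₀.1 \ X.1) (T₀.1 \ T₁.1)
    rw [symmDiff_comm] at h1
    omega
  · by_cases h12 : T₁ = T₂
    · subst h12; exact le_rfl
    · -- `|𝓗₁ ∆ 𝓗₂| ≤ |𝓗₁ ∆ D| + |D ∆ 𝓗₂|`
      have h1 := card_symmDiff_triangle (T₀.1 \ T₁.1) (T₀.1 \ X.1) (T₀.1 \ T₂.1)
      have h2 := hpair T₁ hT₁ T₂ hT₂ h12
      have h3 : ((T₀.1 \ X.1) ∆ (T₀.1 \ T₂.1)).card = ((T₀.1 \ T₂.1) ∆ (T₀.1 \ X.1)).card := by rw [symmDiff_comm]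
      omega
  · by_cases h12 : T₁ = T₂
    · subst h12; omega
    · -- `|𝓗₂ ∆ D| ≤ |𝓗₂ ∆ 𝓗₁| + |𝓗₁ ∆ D|`
      have h1 := card_symmDiff_triangle (T₀.1 \ T₂.1) (T₀.1 \ T₁.1) (T₀.1 \ X.1)
      have h2 := hpair T₂ hT₂ T₁ hT₁ (Ne.symm h12)
      omega

include hbase hn hH hpair in
/-- **`bpot X = |𝓗₁ ∆ D|` when `|𝓗₁ ∆ D| ≤ m`** (partner `T₁ = T₀·Q₁⁻¹`). [folklore] -/
theorem bpot_eq_card_symmDiff_of_le_m (hc2 : c * c = 1) (hcen : ∀ x : G, x * c = c * x) (X : CMF G c) {T₁ : CMF G c} (hT₁ : T₁ ∈ 𝒯)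
    {Q₁ : G} (hQ₁ : rt c Q₁ T₀ = T₁) (hD : ((T₀.1 \ T₁.1) ∆ (T₀.1 \ X.1)).card ≤ m) :
    bpot c T₀ X = ((T₀.1 \ T₁.1) ∆ (T₀.1 \ X.1)).card := by
  apply le_antisymm
  · have h := bpot_le c T₀ X Q₁; rwa [hQ₁, ddist_eq_card_symmDiff c T₀ hc2] at h
  · obtain ⟨Q, hQ⟩ := exists_bpot_eq c T₀ X
    rw [hQ]
    exact card_symmDiff_le_ddist_rt_of_le_m c T₀ 𝒯 hbase m hn hH hpair hc2 hcen X hT₁ hD Q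

include hbase hn hH hpair in
/-- **A PARTNER UNIQUELY NEAREST below level `m` of its own frame**: if `|𝓗₁ ∆ D(X)| < m` then every nearest base change of `X` is `T₁ = T₀·Q₁⁻¹`.
[folklore] -/
theorem unique_partner_of_card_lt_m (hc2 : c * c = 1) (hcen : ∀ x : G, x * c = c * x) (X : CMF G c) {T₁ : CMF G c} (hT₁ : T₁ ∈ 𝒯)
    {Q₁ : G} (hQ₁ : rt c Q₁ T₀ = T₁) (hD : ((T₀.1 \ T₁.1) ∆ (T₀.1 \ X.1)).card < m) :
    ∀ Q' : G, ddist (rt c Q' T₀) X = bpot c T₀ X → rt c Q' T₀ = rt c Q₁ T₀ := by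
  intro Q' hQ'
  have hH₁ := hH T₁ hT₁
  rw [hQ₁]
  rw [bpot_eq_card_symmDiff_of_le_m c T₀ 𝒯 hbase m hn hH hpair hc2 hcen X hT₁ hQ₁ hD.le] at hQ'
  rcases hbase Q' with h | h | ⟨T₂, hT₂, h | h⟩
  · exfalso
    rw [h] at hQ'
    change (T₀.1 \ X.1).card = _ at hQ'
    have h1 := card_le_card_symmDiff_add (T₀.1 \ T₁.1) (T₀.1 \ X.1)
    omega
  · exfalso
    rw [h, ddist_compl_base_eq c T₀ hc2 hcen] at hQ'
    have h1 := card_le_card_symmDiff_add (T₀.1 \ X.1) (T₀.1 \ T₁.1)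
    rw [symmDiff_comm] at h1
    omega
  · by_cases h12 : T₁ = T₂
    · subst h12; exact h
    · exfalso
      rw [h, ddist_eq_card_symmDiff c T₀ hc2] at hQ'
      have h1 := card_symmDiff_triangle (T₀.1 \ T₁.1) (T₀.1 \ X.1) (T₀.1 \ T₂.1)
      have h2 := hpair T₁ hT₁ T₂ hT₂ h12
      have h3 : ((T₀.1 \ X.1) ∆ (T₀.1 \ T₂.1)).card = ((T₀.1 \ T₂.1) ∆ (T₀.1 \ X.1)).card := by rw [symmDiff_comm]
      omega
  · exfalso
    by_cases h12 : T₁ = T₂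
    · subst h12
      rw [h, ddist_compl_eq c T₀ hc2 hcen] at hQ'
      have h1 := card_symmDiff_le_add (T₀.1 \ T₁.1) (T₀.1 \ X.1)
      omega
    · rw [h, ddist_compl_eq c T₀ hc2 hcen] at hQ'
      have h1 := card_symmDiff_triangle (T₀.1 \ T₂.1) (T₀.1 \ T₁.1) (T₀.1 \ X.1)
      have h2 := hpair T₂ hT₂ T₁ hT₁ (Ne.symm h12)
      have h4 := card_symmDiff_le_add (T₀.1 \ T₁.1) (T₀.1 \ X.1)
      omega

end Partners

end

end Summit.HodgeConjecture.CorCM.Census.CentralSquares
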